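import Summits.QuantumFields.YangMills.Theorems.FluctuationComparisonRegPrIntLPersistenceSigmaFree
import Summits.QuantumFields.YangMills.Theorems.FluctuationComparisonRegPrIntLPersistenceKFree
import Summits.QuantumFields.YangMills.Theorems.FluctuationComparisonRegPrIntLPersistenceFromHeightwiseBounds
import Summits.QuantumFields.YangMills.Theorems.FluctuationComparisonRegPrIntLPersistenceFromThm1
import Summits.QuantumFields.YangMills.Theorems.FluctuationComparisonRegPrIntLTubeFromThm1
import Literature.MathematicalPhysics.QuantumFieldTheory.Balaban1983to89.T3HeightwiseDensityBounds
import HarnessLib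

/-!
# LINE g23-1 «stability_letters» — the two K-UNIFORM letters ⟨UP⟩, ⟨LOW⟩ of PERS₁∘ ∕ TUBE∘ ARE BAŁABAN'S ULTRAVIOLET-STABILITY PAIR
# (5)+(6) of [Balaban1985UV3] READ IN THE QUOTIENT CURRENCY `Z_K⁻¹ρ_{K−(J+1)}` AT ONE HEIGHT — organ-level line on crux
# `UnitScaleTilt.FluctuationComparisonRegPrIntL` (stmt-QuantumFields-20520; rung R3 `T3YM3TorusStatement.YM3TorusSU2`), lens «control»

Seat `ym-r3-idea-1` (D-0145 ideator, generation g23), cell `ym3-torus`.  PUBLISHED, NOT REGISTERED (★★OWNER RULING №36 (3)).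
v1.1 (2026-08-30): §5 added — ★★★ `oneLevelPersistenceIntCan_of_stability : UP∘ → LOWB∘ → PERS₁∘` VERBATIM with NO third letter, through
px8-20520 g14's ✓p765564 `…PersistenceKFree.oneLevelPersistenceIntCan_of_up_low` (K-free side CLOSED in the tree by the hands).  CREDIT ∕ JUNCTION
OF RECORD: LEAD w3-20520 g18's ✓`Theorems/FluctuationComparisonRegPrIntLPersistenceFromHeightwiseBounds.lean` (tree 07:31Z, 7 min BEFORE this
file's v1; independent) proves the same reading — `up_of_heightwiseUpperBound` (= §2 `restrict_map_descendTo_le_of_upper` at `n = J+1`),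
`low_of_heightwiseLowerDensity`, `oneLevelPersistenceIntCan_of_heightwiseBounds_smallMass`; what THIS file adds is the ROW LOWB∘ with the print's
window quantifiers (`bB pB` thresholds, `γ₁` after `b₀ p₀`, `cl` after `F γ n` before `K`), the TUBE∘ junction §4, the third-letter-free ★★★ §5,
and the probes (BC7 2∕2 CLEAN, BC2 8∕8 must-fail).
v2 (2026-08-30, prices P1–P4 of idea-crit-5 verdict #455 = PASS-WITH-PRICE (light)): (P1) the LEAD's file is IMPORTED and §3∕§4 derive ⟨UP⟩∕⟨LOW⟩
THROUGH ITS NAMES (`up_of_heightwiseUpperBound`, `low_of_heightwiseLowerBoundOnSmall`, `low_of_heightwiseLowerDensity`); v1's duplicate §2 lemmas are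
DELETED; this line's OWN content is restated as (a) organ-row PACKAGING — UP∘ = the `(c,b₀,p₀)`-free ∀L∃γ₁-closure of the lit schema, LOWB∘ = the
`b₀`-FAMILY window floor at ALL heights with `γ₁` after `(b₀,p₀)` (the LEAD's hypothesis (ii) is the single window `θ_{J+1}(c·b₀)`; LOWB∘ implies it by
`θBal` monotonicity, ★ below), (b) the TUBE∘ dock §4 (doubled window `2θ(b₀) = θ(2b₀)` — not in the tree), (c) the instrument letter FL-7 (scored: 0 KILL;
HIT a∕b∕c∕e, MISS d); (P2) LOWB∘'s datum-χ reading docks to the LEAD's ✓`…HeightwiseQuotientOfBounds5` (`bounds5LowerOnSmall_of_minimiserShape`,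
`regularityLetter_of_fibrePoint`), §2 note; (P3) the «exact-Haar-compatibility audit» of v1's card is RETRACTED as a row-killer: Bałaban's `T`
PRESERVES INTEGRALS ((6) p.257 «∫dU ρ_k = ∫dU T^kρ₀ = ∫dU ρ₀»), so `ρ_k` IS the Haar density of the push-forward law = the tree's `towerDensity`
(lit ✓`emlDensity_eq_towerDensity`, ✓`integral_towerDensity_mul`), and `(blockAvg ℰp)_*Haar ≠ Haar` (`T1 ≢ 1`) has NO typed consequence against UP∘ at
`β_K > 0` — no cheap in-tree killer of UP∘∕LOWB∘ is known to this seat; (P4) §6 corollary `heightwiseLowerBoundOnSmall_of_stabilityLower` : LOWB∘ → the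
∀L∃γ₁-closure of lit `HeightwiseLowerBoundOnSmall` (TRUE on paper in the critic's battery, now kernel-checked).  §7 (v2): BOTH organ rows from the two
stability rows AND NOTHING ELSE, through the hands' ★★★★ knits landed while this v2 was written — ★★★`sectionTubeMassIntCan_of_stability : UP∘ → LOWB∘ →
TUBE∘` VERBATIM (w4-20520 g18 ✓`…TubeFromThm1`, 08:05Z: ⟨HAAR-TUBE₁⟩ is now a THEOREM, v1 §4's third letter is gone) and ★★★`oneLevelPersistenceIntCan_of_stability'`
(LEAD ✓`…PersistenceFromThm1`, 08:00Z; same mathematics as §5 through a second name); conclusions = tree `Lines/persistence_geometry.lean` row texts, match TRUE∕TRUE.  CURRENCY (instrument's FL-7 note): the rows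
ARE in the RESCALED currency — every height `n` is the UNIT lattice `F.P n` with the running coupling (`scheme_β_succ`), group-valued bonds need no
amplitude rescaling, and the window `θBal … n` is Bałaban's ε at coupling `g_{K−n}`.
**HONESTY.**  Nothing of Bałaban's is asserted: the two rows below are `sorry`d STUBS (hypothesis schemas), NOT proved; PERS₁∘, TUBE∘, POS∘,
20520, `YM3TorusSU2` are NOT proved; rung R3 is continuum SU(2) Yang–Mills on T³ — NOT d = 4, NOT infinite volume, NOT a mass gap, NOT the
Clay problem; no summit is proved by a line.

## The control reading (lens «control»: a controlling quantity along the RG flow)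

Bałaban's flow `ρ_{k+1} = Tρ_k` ((2) p.256) of ONE run `K` is a dynamical system in the level `k = 0 … K`; Theorem 1 p.257 («ultraviolet
stability») is LYAPUNOV STABILITY of that flow: the two-sided bounds (5) «χ(U) exp[−(1/g_k²)A^η(U_k(U)) − O(1)|T₁^{(k)}|] ≤ ρ_k(U) ≤ exp O(1)|T₁^{(k)}|»
with «the constant O(1) independent of ε, k, g_k in a bounded set» (p.257 L1), `χ` the characteristic function of (4) «|U(∂p) − 1| < ε₁»
with «ε₁ = g₀p(g₀), p(g) = b₀(1 + log g⁻¹)^{p₀}, p₀ > 2 and b₀ a sufficiently large absolute constant» (p.257, after (7)), and (6)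
«∫dU ρ_k = ∫dU T^kρ₀ = ∫dU ρ₀ = Z^ε … uniform in ε bounds for the partition function».  The CONTROLLING QUANTITY of this line is the
STABILITY PAIR at flow time `k = K − n` in the quotient currency in which Bałaban's normalisation `E` cancels
(`T3HeightwiseDensityBounds`, module docstring): `sup_V Z_K⁻¹ρ_{K−n}(V)` and `inf_{V ∈ window_n} Z_K⁻¹ρ_{K−n}(V)`, where
`Z_K⁻¹ρ_{K−n} = Z_K⁻¹·heightDensity F γ (n ≤ K) univ` IS the density of the run-`K` law of height `n`, `(D_{n,K})_*Gibbs_K`, with respect to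
product Haar (`T3TiltDescent.map_descendTo_restrict_eq_withDensity`, proved in the tree).

## What this file proves (kernel-checked, 0 sorry outside the two stubs)

* ROW UP∘ `StabilityUpperCan` := the tree's EXISTING schema `T3HeightwiseDensityBounds.HeightwiseUpperBound F γ` (work item wi-87190, the
  input of route UVClassRigidity's `stub_heightwiseCompactness`) under a per-`L` coupling threshold — BY NAME, so ONE proof of (5)-upper∕(6)
  serves this organ AND crux 26905's compactness step (dedup across routes);
* ROW LOWB∘ `StabilityLowerWindowCan` := (5)-lower∕(6) on BAŁABAN'S window `{PlaqSmall (θBal F.L γ b₀ p₀ n)}` for `b₀ ≥ bB`, `p₀ ≥ pB`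
  (print: `b₀` large absolute, `p₀ > 2`), constant `cl` after `F, γ, n`, before `K` — a NEW typed text (the tree's
  `HeightwiseLowerBoundOnSmall` chooses its window AFTER `γ, n` and cannot serve a `θBal` window);
* `restrict_map_descendTo_le_of_upper` : UP∘ at `(F, γ)` ⟹ for EVERY height `n` ONE `C > 0` with `ν_{K,n}⌊A ≤ C·dU_n⌊A` for every run
  `K ≥ n` and EVERY set `A` — the letter ⟨UP⟩ is the case `n = J+1`, `A = D⁻¹W_J(c·b₀)`;
* `smul_restrict_le_map_descendTo_of_lower` : an a.e. lower bound on a window `θB` ⟹ `cl·dU_n⌊{PlaqSmall θ} ≤ ν_{K,n}⌊{PlaqSmall θ}` for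
  every `θ ≤ θB` — the letter ⟨LOW⟩ on `S′ = {PlaqSmall θ_{J+1}(c·b₀)}` (✓p764726) and on `S⁺ = {PlaqSmall 2θ_{J+1}(b₀)}` (✓p764339) are
  the cases `θB = θ_{J+1}(max b₀ bB)` resp. `θ_{J+1}(max 2b₀ bB)` (`θBal` is linear in `b₀`: `T3InteriorExcision.θBal_mul`);
* ★ `persLetters_of_stability` : UP∘ → LOWB∘ → the conjunct «∃ C cl > 0, ∀ K ≥ J+1, ⟨UP⟩ ∧ ⟨LOW(S′)⟩» of ✓p764726
  `oneLevelPersistenceIntCan_of_up_low_smallMass` IN ITS PREFIX (`∀ L ∃ c₀ … ∀ c ≤ c₀ ∃ pS ∀ b₀ p₀ … ∃ γ₁ ∀ F γ … ∀ J`), byte for byte;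
* ★★ `oneLevelPersistenceIntCan_of_stability_smallMass` : UP∘ → LOWB∘ → ⟨SMALL-MASS₁(S′)⟩ (the K-FREE third letter, in the same prefix) →
  PERS₁∘ `OneLevelPersistenceIntCan` VERBATIM (`Lines/persistence_geometry.lean` 970dcf79 ll.93–101), through ✓p764726;
* ★ `tubeLetters_of_stability` : UP∘ → LOWB∘ → the conjunct «∃ C cl > 0, ∀ K ≥ J+1, ⟨UP⟩ ∧ ⟨LOW(S⁺)⟩» of ✓p764339
  `sectionTubeMassIntCan_of_up_low_haarTube` in ITS prefix (with `γ₁ ≤ 1`);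
* ★★ `sectionTubeMassIntCan_of_stability_haarTube` : UP∘ → LOWB∘ → ⟨HAAR-TUBE₁⟩ (K-FREE, in the same prefix) → TUBE∘ `SectionTubeMassIntCan`
  VERBATIM (`Lines/persistence_geometry.lean` 970dcf79 ll.137–158; census hash 19087cd2131fcb50), through ✓p764339 §4;
* ★★★ (v1.1) `oneLevelPersistenceIntCan_of_stability` : UP∘ → LOWB∘ → PERS₁∘ VERBATIM, NO K-free letter left (✓p765564); by-name concluder
  `oneLevelPersistenceIntCan_of_stubs` — so, CONDITIONAL on the two stability rows ONLY, the organ's persistence row holds; the rows are NOT proved.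

So the organ's K-UNIFORM side («untouched and nobody's», LEAD w3 g18 07:10:42Z) is EXACTLY Theorem 1 + (6) of [Balaban1985UV3] at the single
height `n = J+1`, and its upper half is a schema the tree already carries for another route.  WHY IT MIGHT FAIL (rows): the tree's densities
are the pinned-`ℰp` Radon–Nikodym densities on `SU(2)`, for which (5) is the cell's located-unprinted construction statement (exact-Haar-
compatibility point, `T3HeightwiseDensityBounds` docstring); LOWB∘ reads `χ` on the DATUM's plaquettes ((4)–(5)) where (47) p.267 has `χ_k`
on the minimiser's fine plaquettes, and converts `(1/g_{K−n}²)A^η(U_{K−n}(U)) = O(p(g_{K−n})²)|T₁^{(K−n)}|` on the window by the regularity of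
the minimiser ([Balaban1985Variational] Thm 1) — a reading, flagged.  CHEAPEST FALSIFIER: instrument letter FL-7 (card §falsifier): the
two-sided histogram of `log Z_K⁻¹ρ_{K−n}` on the window across `K = n+1 … n+4` at fixed `n` must be `K`-flat.

References: T. Bałaban, CMP 102 (1985) 255–275 [Balaban1985UV3] ((1)–(7) pp.256–257, Thm 1 p.257, (41) p.266, (47) p.267); CMP 102 (1985)
277–309 [Balaban1985Variational] (Thm 1); CMP 98 (1985) 17–51 [Balaban1985Averaging] ((10) p.19, Prop. 1 p.22).
-/

noncomputable section

set_option autoImplicit false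

open MeasureTheory Filter Topology Set
open scoped ENNReal NNReal
open Literature.MathematicalPhysics.QuantumFieldTheory.Balaban1983to89
open Literature.MathematicalPhysics.QuantumFieldTheory.Balaban1983to89.T3ContinuumYM3Torus
open Literature.MathematicalPhysics.QuantumFieldTheory.Balaban1983to89.T3NestedUnitLaws
open Literature.MathematicalPhysics.QuantumFieldTheory.Balaban1983to89.T3UnitLawDensityEML
open Literature.MathematicalPhysics.QuantumFieldTheory.Balaban1983to89.T3UnitScaleTilt
open Literature.MathematicalPhysics.QuantumFieldTheory.Balaban1983to89.T3TiltDescent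
open Literature.MathematicalPhysics.QuantumFieldTheory.Balaban1983to89.T3DescentFibreTower
open Literature.MathematicalPhysics.QuantumFieldTheory.Balaban1983to89.T3HeightwiseDensityBounds
open Literature.MathematicalPhysics.QuantumFieldTheory.Balaban1983to89.T3InteriorExcision (θBal_mul)
open Literature.MathematicalPhysics.QuantumFieldTheory.Balaban1983to89.T3MinimiserStabilityReduction (θBal_pos)
open Literature.MathematicalPhysics.QuantumFieldTheory.Balaban1983to89.Missing
open Summit.QuantumFields.YangMills.Theorems.FluctuationComparisonRegPrIntLPersistenceSigmaFree

open Summit.QuantumFields.YangMills.Theorems.FluctuationComparisonRegPrIntLPersistenceFromHeightwiseBounds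
  (up_of_heightwiseUpperBound low_of_heightwiseLowerDensity low_of_heightwiseLowerBoundOnSmall)

namespace Summit.QuantumFields.YangMills.Cruxes.FluctuationComparisonRegPrIntL.StabilityLetters

/-! ## §1 The two rows (stubs; hypothesis schemas, NOT proved) -/

/-- ROW UP∘ — **HEIGHTWISE `K`-UNIFORM UPPER STABILITY, per block size**: for every `L` a coupling threshold `γ₁(L)` below which every
three-torus family of block size `L` satisfies the tree's schema `HeightwiseUpperBound F γ` (for every height `n` ONE `C_n` with
`Z_K⁻¹ρ_{K−n} ≤ C_n` a.e. for all runs `K ≥ n`).  = [Balaban1985UV3] (5) upper half at `k = K − n` over (6), Bałaban's `E` cancelling in the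
quotient; for the pinned `ℰp` densities the cell's located-unprinted construction statement.  XL (port of Thm 1's upper bound = Sects. A–D).
Shared with wi-87190 ∕ crux 26905 `stub_heightwiseCompactness` BY NAME. [cite: Balaban1985UV3, (5) p.256, (6) p.257, Thm 1 p.257] -/
def StabilityUpperCan : Prop :=
  ∀ (L : ℕ), ∃ γ₁ : ℝ, 0 < γ₁ ∧ ∀ (F : T3Family) (γ : ℝ), F.L = L → 0 < γ → γ ≤ γ₁ → HeightwiseUpperBound F γ

/-- Stub of ROW UP∘ (NOT proved; the row is a hypothesis of every junction below). [cite: Balaban1985UV3, (5) p.256, (6) p.257, Thm 1 p.257] -/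
theorem stub_stabilityUpper : StabilityUpperCan := by
  sorry

/-- ROW LOWB∘ — **HEIGHTWISE `K`-UNIFORM LOWER STABILITY ON BAŁABAN'S WINDOW, per block size**: for every `L` thresholds `bB, pB` such that
for all window constants `b₀ ≥ bB`, `p₀ ≥ pB` there is a coupling threshold `γ₁` (AFTER `b₀, p₀`) below which, for every height `n`, ONE
`cl > 0` (after `F, γ, n`, BEFORE `K`) bounds the normalised height-`n` density from below a.e. on the all-small window
`{PlaqSmall (θBal F.L γ b₀ p₀ n)}` (`θ(n) = g_n p(g_n)`, `g_n² = γL^{−n}`), for all runs `K ≥ n`.  = (5) lower half («χ(U) exp[−(1/g_k²)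
A^η(U_k(U)) − O(1)|T₁^{(k)}|] ≤ ρ_k(U)», `χ` = (4) with «ε₁ = g₀p(g₀) … p₀ > 2 and b₀ a sufficiently large absolute constant», p.257) at
`k = K − n`, where on the window `(1/g_{K−n}²)A^η(U_{K−n}(U)) = O(p(g_{K−n})²)|T₁^{(K−n)}|` by the regularity of the minimiser
([Balaban1985Variational] Thm 1 — a READING, not printed in (5)), over the upper bound of `e^{−E}Z` from (5) at `k = K` and (6).  XL.
Why it might fail: `χ` of (47) p.267 sits on the minimiser's fine plaquettes, not the datum's; pinned `ℰp` ≠ print's averaging (10)+(0.4).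
[cite: Balaban1985UV3, (4)-(5) p.256, (6)-(7) p.257, (47) p.267] -/
def StabilityLowerWindowCan : Prop :=
  ∀ (L : ℕ), ∃ bB pB : ℝ, ∀ (b₀ p₀ : ℝ), bB ≤ b₀ → pB ≤ p₀ →
    ∃ γ₁ : ℝ, 0 < γ₁ ∧ ∀ (F : T3Family) (γ : ℝ), F.L = L → 0 < γ → γ ≤ γ₁ →
      ∀ (n : ℕ), ∃ cl : ℝ, 0 < cl ∧ ∀ (K : ℕ) (hK : n ≤ K),
        ∀ᵐ V ∂(fieldMeasure (F.P n) 0 (Matrix.specialUnitaryGroup (Fin 2) ℂ)),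
          PlaqSmall (θBal F.L γ b₀ p₀ n) V →
            cl ≤ (partitionFn (G := Matrix.specialUnitaryGroup (Fin 2) ℂ) (F.P K) ((F.scheme ℰp γ).β K))⁻¹ *
              heightDensity F γ hK Set.univ V

/-- Stub of ROW LOWB∘ (NOT proved). [cite: Balaban1985UV3, (4)-(5) p.256, (6)-(7) p.257, (47) p.267] -/
theorem stub_stabilityLowerWindow : StabilityLowerWindowCan := by
  sorry

/-! ## §2 One run, one height: the letters from the stability pair — THROUGH THE LEAD's NAMES (v2, price P1 of verdict #455) -/

/- v2 (P1 of idea-crit-5 verdict #455): v1's `restrict_map_descendTo_le_of_upper` and `smul_restrict_le_map_descendTo_of_lower` are DELETED —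
they duplicated LEAD w3-20520's ✓`Theorems/FluctuationComparisonRegPrIntLPersistenceFromHeightwiseBounds` (2026-08-30T07:31Z):
`up_of_heightwiseUpperBound` (⟨UP⟩ at height `J+1` from `HeightwiseUpperBound F γ`), `low_of_heightwiseLowerDensity` (⟨LOW on S⟩ from an a.e.
lower density bound on `S`) and `low_of_heightwiseLowerBoundOnSmall` (the window instance with `θ_{J+1}(c·b₀) ≤ δ`), which §3∕§4 below now call BY NAME.
The fibre∕minimiser READING of the lower row is the LEAD's ✓`Theorems/FluctuationComparisonRegPrIntLHeightwiseQuotientOfBounds5` (07:38Z):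
`heightwiseLowerBoundOnSmall_of_bounds5TwoSided`, `bounds5LowerOnSmall_of_minimiserShape` (the (47)-shape over `T3ConstrainedMinimiser.minAction`),
`regularityLetter_of_fibrePoint` (ONE fine field over each window datum with `β_K·A ≤ A₀` ⇒ the minimiser's action is `≤ A₀`) — LOWB∘'s datum-χ
reading docks THERE (price P2): LOWB∘ at height `n` ⟸ a `Bounds5`-type two-sided quotient bound on `{PlaqSmall θ_n(b₀)}` whose lower constant is
`exp(−A₀ − R)` with `A₀(F,γ,n)` the regularity letter's bound, K-free by (6). -/

/-- Window comparison: `θ(c·b₀) ≤ θ(b₀')` whenever `c·b₀ ≤ b₀'` (`θBal` is linear in `b₀` and positive; `0 < γ ≤ 1`, `1 ≤ L`).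
[cite: Balaban1985UV3, (7) p.257] -/
theorem θBal_le_of_mul_le {L : ℕ} (hL : 1 ≤ L) {γ : ℝ} (hγ : 0 < γ) (hγ1 : γ ≤ 1) {c b₀ b₀' : ℝ} (hcb : c * b₀ ≤ b₀')
    (p₀ : ℝ) (i : ℕ) : θBal L γ (c * b₀) p₀ i ≤ θBal L γ b₀' p₀ i := by
  have e1 : θBal L γ (c * b₀) p₀ i = (c * b₀) * θBal L γ 1 p₀ i := by
    rw [← θBal_mul L γ (c * b₀) 1 p₀ i, mul_one]
  have e2 : θBal L γ b₀' p₀ i = b₀' * θBal L γ 1 p₀ i := by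
    rw [← θBal_mul L γ b₀' 1 p₀ i, mul_one]
  rw [e1, e2]
  exact mul_le_mul_of_nonneg_right hcb (θBal_pos hL hγ hγ1 one_pos p₀ i).le

/-! ## §3 The organ prefix: ⟨UP⟩ + ⟨LOW(S′)⟩ of ✓p764726 from the two rows, and PERS₁∘ verbatim (PROVED junctions) -/

/-- ★ **THE ⟨UP⟩ + ⟨LOW(S′)⟩ CONJUNCT OF ✓p764726 IN ITS PREFIX, FROM UP∘ + LOWB∘** (`c₀ := 1`, `pS := pB`, the lower row at the enlarged
window constant `max b₀ bB`, `γ₁ := min γ₁ᵁ γ₁ᴸ 1`; `C` from §2 at `n = J+1`, `cl` from LOWB∘ at `n = J+1`).  CONDITIONAL on the two rows;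
nothing of Bałaban's is proved. [cite: Balaban1985UV3, (5)-(7) pp.256-257] -/
theorem persLetters_of_stability (hU : StabilityUpperCan) (hLo : StabilityLowerWindowCan) :
    ∀ (L : ℕ), ∃ c₀ : ℝ, 0 < c₀ ∧ c₀ ≤ 1 ∧ ∀ (c : ℝ), 0 < c → c ≤ c₀ → ∃ pS : ℝ, ∀ (b₀ p₀ : ℝ), 0 < b₀ → pS ≤ p₀ → 0 < p₀ →
      ∃ γ₁ : ℝ, 0 < γ₁ ∧ ∀ (F : T3Family) (γ : ℝ), F.L = L → 0 < γ → γ ≤ γ₁ → ∀ (J : ℕ),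
        ∃ C cl : ℝ, 0 < C ∧ 0 < cl ∧ ∀ (K : ℕ) (hJK : J + 1 ≤ K),
          ((gibbsK F ℰp γ K).map (descendTo F ℰp (J + 1) K hJK)).restrict
              (descendTo F ℰp J (J + 1) (Nat.le_succ J) ⁻¹' {U | PlaqSmall (θBal F.L γ (c * b₀) p₀ J) U}) ≤
            ENNReal.ofReal C • (fieldMeasure (F.P (J + 1)) 0 (Matrix.specialUnitaryGroup (Fin 2) ℂ)).restrict
              (descendTo F ℰp J (J + 1) (Nat.le_succ J) ⁻¹' {U | PlaqSmall (θBal F.L γ (c * b₀) p₀ J) U}) ∧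
          ENNReal.ofReal cl • (fieldMeasure (F.P (J + 1)) 0 (Matrix.specialUnitaryGroup (Fin 2) ℂ)).restrict
              {V | PlaqSmall (θBal F.L γ (c * b₀) p₀ (J + 1)) V} ≤
            ((gibbsK F ℰp γ K).map (descendTo F ℰp (J + 1) K hJK)).restrict {V | PlaqSmall (θBal F.L γ (c * b₀) p₀ (J + 1)) V} := by
  intro L
  obtain ⟨γU, hγU, hUF⟩ := hU L
  obtain ⟨bB, pB, hLoF⟩ := hLo L
  refine ⟨1, one_pos, le_rfl, fun c hc hc1 => ⟨pB, fun b₀ p₀ hb₀ hpB hp₀ => ?_⟩⟩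
  obtain ⟨γL, hγL, hLF⟩ := hLoF (max b₀ bB) p₀ (le_max_right _ _) hpB
  refine ⟨min (min γU γL) 1, lt_min (lt_min hγU hγL) one_pos, fun F γ hFL hγ hγle J => ?_⟩
  have hγU' : γ ≤ γU := hγle.trans ((min_le_left _ _).trans (min_le_left _ _))
  have hγL' : γ ≤ γL := hγle.trans ((min_le_left _ _).trans (min_le_right _ _))
  have hγ1 : γ ≤ 1 := hγle.trans (min_le_right _ _)
  obtain ⟨C, hC, hCup⟩ := up_of_heightwiseUpperBound F hγ.le (hUF F γ hFL hγ hγU') J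
  obtain ⟨cl, hcl, hcllow⟩ := hLF F γ hFL hγ hγL' (J + 1)
  refine ⟨C, cl, hC, hcl, fun K hJK => ⟨hCup K hJK _, ?_⟩⟩
  have hθ : θBal F.L γ (c * b₀) p₀ (J + 1) ≤ θBal F.L γ (max b₀ bB) p₀ (J + 1) :=
    θBal_le_of_mul_le F.hL.2.le hγ hγ1 ((mul_le_of_le_one_left hb₀.le hc1).trans (le_max_left _ _)) p₀ (J + 1)
  exact low_of_heightwiseLowerBoundOnSmall F hγ.le c b₀ p₀ hθ hcllow K hJK

/-- ★★ **PERS₁∘ `OneLevelPersistenceIntCan` VERBATIM ⟸ UP∘ + LOWB∘ + ⟨SMALL-MASS₁(S′)⟩** (`Lines/persistence_geometry.lean` 970dcf79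
ll.93–101 = `Lines/persistence_floor.lean` §2), through ✓p764726 `oneLevelPersistenceIntCan_of_up_low_smallMass`: the two K-UNIFORM letters
are discharged by the stability rows (§3 `persLetters_of_stability`), the K-FREE third letter ⟨SMALL-MASS₁⟩ (one-step Haar kinematics of
`ℰp`, [Balaban1985Averaging] Prop. 1 — hands px8∕w4∕px20) stays a hypothesis in the same prefix; prefixes merged by `min`∕`max`.
CONDITIONAL; PERS₁∘ is NOT proved here. [cite: Balaban1985UV3, (5)-(7) pp.256-257; Balaban1985Averaging, Prop. 1 p.22] -/
theorem oneLevelPersistenceIntCan_of_stability_smallMass (hU : StabilityUpperCan) (hLo : StabilityLowerWindowCan)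
    (hSM : ∀ (L : ℕ), ∃ c₀ : ℝ, 0 < c₀ ∧ c₀ ≤ 1 ∧ ∀ (c : ℝ), 0 < c → c ≤ c₀ → ∃ pS : ℝ, ∀ (b₀ p₀ : ℝ), 0 < b₀ → pS ≤ p₀ → 0 < p₀ →
      ∃ γ₁ : ℝ, 0 < γ₁ ∧ ∀ (F : T3Family) (γ : ℝ), F.L = L → 0 < γ → γ ≤ γ₁ → ∀ (J : ℕ),
        ∃ q₀ : ℝ, 0 < q₀ ∧ ∀ (B : Set (GaugeField (F.P J) 0 (Matrix.specialUnitaryGroup (Fin 2) ℂ))), MeasurableSet B →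
          B ⊆ {U | PlaqSmall (θBal F.L γ (c * b₀) p₀ J) U} →
          ENNReal.ofReal q₀ * fieldMeasure (F.P (J + 1)) 0 (Matrix.specialUnitaryGroup (Fin 2) ℂ)
              (descendTo F ℰp J (J + 1) (Nat.le_succ J) ⁻¹' B) ≤
            fieldMeasure (F.P (J + 1)) 0 (Matrix.specialUnitaryGroup (Fin 2) ℂ)
              (descendTo F ℰp J (J + 1) (Nat.le_succ J) ⁻¹' B ∩ {V | PlaqSmall (θBal F.L γ (c * b₀) p₀ (J + 1)) V})) :
    ∀ (L : ℕ), ∃ c₀ : ℝ, 0 < c₀ ∧ c₀ ≤ 1 ∧ ∀ (c : ℝ), 0 < c → c ≤ c₀ → ∃ pS : ℝ, ∀ (b₀ p₀ : ℝ), 0 < b₀ → pS ≤ p₀ → 0 < p₀ →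
      ∃ γ₁ : ℝ, 0 < γ₁ ∧ ∀ (F : T3Family) (γ : ℝ), F.L = L → 0 < γ → γ ≤ γ₁ →
        ∀ (J : ℕ), ∃ q : ℝ, 0 < q ∧ ∀ (K : ℕ) (hJK : J + 1 ≤ K)
          (B : Set (GaugeField (F.P J) 0 (Matrix.specialUnitaryGroup (Fin 2) ℂ))), MeasurableSet B →
            B ⊆ {U | PlaqSmall (θBal F.L γ (c * b₀) p₀ J) U} →
            ENNReal.ofReal q * gibbsK F ℰp γ K (descendTo F ℰp J K ((Nat.le_succ J).trans hJK) ⁻¹' B) ≤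
              gibbsK F ℰp γ K (descendTo F ℰp J K ((Nat.le_succ J).trans hJK) ⁻¹' B ∩
                descendTo F ℰp (J + 1) K hJK ⁻¹' {V | PlaqSmall (θBal F.L γ (c * b₀) p₀ (J + 1)) V}) := by
  refine oneLevelPersistenceIntCan_of_up_low_smallMass fun L => ?_
  obtain ⟨c₀, hc₀, hc₀1, hcUL⟩ := persLetters_of_stability hU hLo L
  obtain ⟨c₀', hc₀', -, hcSM⟩ := hSM L
  refine ⟨min c₀ c₀', lt_min hc₀ hc₀', (min_le_left _ _).trans hc₀1, fun c hc hcle => ?_⟩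
  obtain ⟨pS, hpS⟩ := hcUL c hc (hcle.trans (min_le_left _ _))
  obtain ⟨pS', hpS'⟩ := hcSM c hc (hcle.trans (min_le_right _ _))
  refine ⟨max pS pS', fun b₀ p₀ hb₀ hp hp₀ => ?_⟩
  obtain ⟨γ₁, hγ₁, h1⟩ := hpS b₀ p₀ hb₀ ((le_max_left _ _).trans hp) hp₀
  obtain ⟨γ₁', hγ₁', h2⟩ := hpS' b₀ p₀ hb₀ ((le_max_right _ _).trans hp) hp₀
  refine ⟨min γ₁ γ₁', lt_min hγ₁ hγ₁', fun F γ hFL hγ hγle J => ⟨?_, ?_⟩⟩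
  · exact h1 F γ hFL hγ (hγle.trans (min_le_left _ _)) J
  · exact h2 F γ hFL hγ (hγle.trans (min_le_right _ _)) J

/-! ## §4 The TUBE∘ prefix: ⟨UP⟩ + ⟨LOW(S⁺)⟩ of ✓p764339 from the two rows (PROVED junction) -/

/-- ★ **THE ⟨UP⟩ + ⟨LOW(S⁺)⟩ CONJUNCT OF ✓p764339 `sectionTubeMassIntCan_of_up_low_haarTube` IN ITS PREFIX (with `γ₁ ≤ 1`), FROM
UP∘ + LOWB∘** — the doubled window `S⁺ = {PlaqSmall (2·θ_{J+1}(b₀))}` is served by LOWB∘ at the window constant `max (2b₀) bB`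
(`2·θ(b₀) = θ(2b₀)`).  With ⟨HAAR-TUBE₁⟩ added in the same prefix, TUBE∘ `SectionTubeMassIntCan` (`Lines/persistence_geometry.lean`
ll.137–158) follows verbatim by ✓p764339 §4.  CONDITIONAL on the two rows. [cite: Balaban1985UV3, (5)-(7) pp.256-257] -/
theorem tubeLetters_of_stability (hU : StabilityUpperCan) (hLo : StabilityLowerWindowCan) :
    ∀ (L : ℕ), ∃ c₀ : ℝ, 0 < c₀ ∧ c₀ ≤ 1 ∧ ∀ (c : ℝ), 0 < c → c ≤ c₀ → ∃ pS : ℝ, ∀ (b₀ p₀ : ℝ), 0 < b₀ → pS ≤ p₀ → 0 < p₀ →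
      ∃ γ₁ : ℝ, 0 < γ₁ ∧ γ₁ ≤ 1 ∧ ∀ (F : T3Family) (γ : ℝ), F.L = L → 0 < γ → γ ≤ γ₁ → ∀ (J : ℕ),
        ∃ C cl : ℝ, 0 < C ∧ 0 < cl ∧ ∀ (K : ℕ) (hJK : J + 1 ≤ K),
          ((gibbsK F ℰp γ K).map (descendTo F ℰp (J + 1) K hJK)).restrict
              (descendTo F ℰp J (J + 1) (Nat.le_succ J) ⁻¹' {U | PlaqSmall (θBal F.L γ (c * b₀) p₀ J) U}) ≤
            ENNReal.ofReal C • (fieldMeasure (F.P (J + 1)) 0 (Matrix.specialUnitaryGroup (Fin 2) ℂ)).restrict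
              (descendTo F ℰp J (J + 1) (Nat.le_succ J) ⁻¹' {U | PlaqSmall (θBal F.L γ (c * b₀) p₀ J) U}) ∧
          ENNReal.ofReal cl • (fieldMeasure (F.P (J + 1)) 0 (Matrix.specialUnitaryGroup (Fin 2) ℂ)).restrict
              {V | PlaqSmall (2 * θBal F.L γ b₀ p₀ (J + 1)) V} ≤
            ((gibbsK F ℰp γ K).map (descendTo F ℰp (J + 1) K hJK)).restrict {V | PlaqSmall (2 * θBal F.L γ b₀ p₀ (J + 1)) V} := by
  intro L
  obtain ⟨γU, hγU, hUF⟩ := hU L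
  obtain ⟨bB, pB, hLoF⟩ := hLo L
  refine ⟨1, one_pos, le_rfl, fun c hc hc1 => ⟨pB, fun b₀ p₀ hb₀ hpB hp₀ => ?_⟩⟩
  obtain ⟨γL, hγL, hLF⟩ := hLoF (max (2 * b₀) bB) p₀ (le_max_right _ _) hpB
  refine ⟨min (min γU γL) 1, lt_min (lt_min hγU hγL) one_pos, min_le_right _ _, fun F γ hFL hγ hγle J => ?_⟩
  have hγU' : γ ≤ γU := hγle.trans ((min_le_left _ _).trans (min_le_left _ _))
  have hγL' : γ ≤ γL := hγle.trans ((min_le_left _ _).trans (min_le_right _ _))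
  have hγ1 : γ ≤ 1 := hγle.trans (min_le_right _ _)
  obtain ⟨C, hC, hCup⟩ := up_of_heightwiseUpperBound F hγ.le (hUF F γ hFL hγ hγU') J
  obtain ⟨cl, hcl, hcllow⟩ := hLF F γ hFL hγ hγL' (J + 1)
  refine ⟨C, cl, hC, hcl, fun K hJK => ⟨hCup K hJK _, ?_⟩⟩
  have hθ : 2 * θBal F.L γ b₀ p₀ (J + 1) ≤ θBal F.L γ (max (2 * b₀) bB) p₀ (J + 1) := by
    rw [← θBal_mul F.L γ 2 b₀ p₀ (J + 1)]
    exact θBal_le_of_mul_le F.hL.2.le hγ hγ1 (le_max_left (2 * b₀) bB) p₀ (J + 1)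
  refine low_of_heightwiseLowerDensity F hγ.le hJK (measurableSet_plaqSmall _) ?_
  filter_upwards [hcllow K hJK] with V hV hVS
  exact hV fun p => ((show PlaqSmall (2 * θBal F.L γ b₀ p₀ (J + 1)) V from hVS) p).trans_le hθ

/-- ★★ **TUBE∘ `SectionTubeMassIntCan` VERBATIM ⟸ UP∘ + LOWB∘ + ⟨HAAR-TUBE₁⟩** (`Lines/persistence_geometry.lean` 970dcf79 ll.137–158),
through ✓p764339 `sectionTubeMassIntCan_of_up_low_haarTube`: the two K-UNIFORM letters from the stability rows (§4 `tubeLetters_of_stability`),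
the K-FREE letter ⟨HAAR-TUBE₁⟩ (one-step Haar kinematics of `ℰp` about a measurable section, [Balaban1985Averaging] Prop. 1) a hypothesis in
the same prefix; prefixes merged by `min`∕`max`.  CONDITIONAL; TUBE∘ is NOT proved here.
[cite: Balaban1985UV3, (5)-(7) pp.256-257; Balaban1985Averaging, Prop. 1 p.22] -/
theorem sectionTubeMassIntCan_of_stability_haarTube (hU : StabilityUpperCan) (hLo : StabilityLowerWindowCan)
    (hHT : ∀ (L : ℕ), ∃ c₀ : ℝ, 0 < c₀ ∧ c₀ ≤ 1 ∧ ∀ (c : ℝ), 0 < c → c ≤ c₀ → ∃ pS : ℝ, ∀ (b₀ p₀ : ℝ), 0 < b₀ → pS ≤ p₀ → 0 < p₀ →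
      ∃ γ₁ : ℝ, 0 < γ₁ ∧ ∀ (F : T3Family) (γ : ℝ), F.L = L → 0 < γ → γ ≤ γ₁ → ∀ (J : ℕ) (r : ℝ), 0 < r →
        ∀ σ : GaugeField (F.P J) 0 (Matrix.specialUnitaryGroup (Fin 2) ℂ) → GaugeField (F.P (J + 1)) 0 (Matrix.specialUnitaryGroup (Fin 2) ℂ),
          Measurable σ →
          (∀ U : GaugeField (F.P J) 0 (Matrix.specialUnitaryGroup (Fin 2) ℂ), PlaqSmall (θBal F.L γ (c * b₀) p₀ J) U →
            descendTo F ℰp J (J + 1) (Nat.le_succ J) (σ U) = U ∧ PlaqSmall (θBal F.L γ b₀ p₀ (J + 1)) (σ U)) →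
          ∃ q' : ℝ, 0 < q' ∧ ∀ (B : Set (GaugeField (F.P J) 0 (Matrix.specialUnitaryGroup (Fin 2) ℂ))), MeasurableSet B →
            B ⊆ {U | PlaqSmall (θBal F.L γ (c * b₀) p₀ J) U} →
            ENNReal.ofReal q' * fieldMeasure (F.P (J + 1)) 0 (Matrix.specialUnitaryGroup (Fin 2) ℂ)
                (descendTo F ℰp J (J + 1) (Nat.le_succ J) ⁻¹' B) ≤
              fieldMeasure (F.P (J + 1)) 0 (Matrix.specialUnitaryGroup (Fin 2) ℂ) (descendTo F ℰp J (J + 1) (Nat.le_succ J) ⁻¹' B ∩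
                {V | ∀ b : PBond (F.P (J + 1)) 0, dist1 ((σ (descendTo F ℰp J (J + 1) (Nat.le_succ J) V) b)⁻¹ * V b) < r})) :
    ∀ (L : ℕ), ∃ c₀ : ℝ, 0 < c₀ ∧ c₀ ≤ 1 ∧ ∀ (c : ℝ), 0 < c → c ≤ c₀ → ∃ pS : ℝ, ∀ (b₀ p₀ : ℝ), 0 < b₀ → pS ≤ p₀ → 0 < p₀ →
      ∃ γ₁ : ℝ, 0 < γ₁ ∧ ∀ (F : T3Family) (γ : ℝ), F.L = L → 0 < γ → γ ≤ γ₁ →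
        ∀ (J : ℕ) (r : ℝ), 0 < r →
          ∀ σ : GaugeField (F.P J) 0 (Matrix.specialUnitaryGroup (Fin 2) ℂ) → GaugeField (F.P (J + 1)) 0 (Matrix.specialUnitaryGroup (Fin 2) ℂ),
            Measurable σ →
            (∀ U : GaugeField (F.P J) 0 (Matrix.specialUnitaryGroup (Fin 2) ℂ), PlaqSmall (θBal F.L γ (c * b₀) p₀ J) U →
              descendTo F ℰp J (J + 1) (Nat.le_succ J) (σ U) = U ∧ PlaqSmall (θBal F.L γ b₀ p₀ (J + 1)) (σ U)) →
            ∃ q : ℝ, 0 < q ∧ ∀ (K : ℕ) (hJK : J + 1 ≤ K)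
              (B : Set (GaugeField (F.P J) 0 (Matrix.specialUnitaryGroup (Fin 2) ℂ))), MeasurableSet B →
                B ⊆ {U | PlaqSmall (θBal F.L γ (c * b₀) p₀ J) U} →
                ENNReal.ofReal q * gibbsK F ℰp γ K (descendTo F ℰp J K ((Nat.le_succ J).trans hJK) ⁻¹' B) ≤
                  gibbsK F ℰp γ K (descendTo F ℰp J K ((Nat.le_succ J).trans hJK) ⁻¹' B ∩
                    {V | ∀ b : PBond (F.P (J + 1)) 0,
                      dist1 ((σ (descendTo F ℰp J K ((Nat.le_succ J).trans hJK) V) b)⁻¹ *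
                        descendTo F ℰp (J + 1) K hJK V b) < r}) := by
  refine Summit.QuantumFields.YangMills.Theorems.FluctuationComparisonRegPrIntLSectionTubeSplit.sectionTubeMassIntCan_of_up_low_haarTube
    fun L => ?_
  obtain ⟨c₀, hc₀, hc₀1, hcUL⟩ := tubeLetters_of_stability hU hLo L
  obtain ⟨c₀', hc₀', -, hcHT⟩ := hHT L
  refine ⟨min c₀ c₀', lt_min hc₀ hc₀', (min_le_left _ _).trans hc₀1, fun c hc hcle => ?_⟩
  obtain ⟨pS, hpS⟩ := hcUL c hc (hcle.trans (min_le_left _ _))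
  obtain ⟨pS', hpS'⟩ := hcHT c hc (hcle.trans (min_le_right _ _))
  refine ⟨max pS pS', fun b₀ p₀ hb₀ hp hp₀ => ?_⟩
  obtain ⟨γ₁, hγ₁, hγ₁1, h1⟩ := hpS b₀ p₀ hb₀ ((le_max_left _ _).trans hp) hp₀
  obtain ⟨γ₁', hγ₁', h2⟩ := hpS' b₀ p₀ hb₀ ((le_max_right _ _).trans hp) hp₀
  refine ⟨min γ₁ γ₁', lt_min hγ₁ hγ₁', (min_le_left _ _).trans hγ₁1, fun F γ hFL hγ hγle J => ⟨?_, ?_⟩⟩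
  · exact h1 F γ hFL hγ (hγle.trans (min_le_left _ _)) J
  · exact h2 F γ hFL hγ (hγle.trans (min_le_right _ _)) J

/-! ## §5 (v1.1) PERS₁∘ VERBATIM ⟸ UP∘ + LOWB∘ ALONE (PROVED junction through ✓p765564; the rows are NOT proved) -/

/-- ★★★ **PERS₁∘ `OneLevelPersistenceIntCan` VERBATIM ⟸ UP∘ + LOWB∘, NO THIRD LETTER** (`Lines/persistence_geometry.lean` 970dcf79 ll.93–101 =
`Lines/persistence_floor.lean` §2): §3 `persLetters_of_stability` delivers EXACTLY the hypothesis `hUL` of px8-20520 g14's ✓p765564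
`…PersistenceKFree.oneLevelPersistenceIntCan_of_up_low` (the K-FREE letter ⟨SMALL-MASS₁(S′)⟩ is the tree's hypothesis-free ✓`smallMassInterior`,
behind it ✓`haarTubeRel_depthOne` px20 g11, ✓`haarFloor_histGood_depthOne` p764768, GEOM∘ ✓p763878).  So the organ's persistence row is
CONDITIONAL on [Balaban1985UV3] Thm 1 (5)+(6) at the single height `n = J+1` in the quotient currency, and on NOTHING ELSE.  HONEST: UP∘, LOWB∘
are `sorry`d stubs, NOT proved; PERS₁∘, POS∘, 20520, `YM3TorusSU2` NOT proved. [cite: Balaban1985UV3, (5)-(7) pp.256-257 and Thm 1 p.257] -/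
theorem oneLevelPersistenceIntCan_of_stability (hU : StabilityUpperCan) (hLo : StabilityLowerWindowCan) :
    ∀ (L : ℕ), ∃ c₀ : ℝ, 0 < c₀ ∧ c₀ ≤ 1 ∧ ∀ (c : ℝ), 0 < c → c ≤ c₀ → ∃ pS : ℝ, ∀ (b₀ p₀ : ℝ), 0 < b₀ → pS ≤ p₀ → 0 < p₀ →
      ∃ γ₁ : ℝ, 0 < γ₁ ∧ ∀ (F : T3Family) (γ : ℝ), F.L = L → 0 < γ → γ ≤ γ₁ →
        ∀ (J : ℕ), ∃ q : ℝ, 0 < q ∧ ∀ (K : ℕ) (hJK : J + 1 ≤ K)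
          (B : Set (GaugeField (F.P J) 0 (Matrix.specialUnitaryGroup (Fin 2) ℂ))), MeasurableSet B →
            B ⊆ {U | PlaqSmall (θBal F.L γ (c * b₀) p₀ J) U} →
            ENNReal.ofReal q * gibbsK F ℰp γ K (descendTo F ℰp J K ((Nat.le_succ J).trans hJK) ⁻¹' B) ≤
              gibbsK F ℰp γ K (descendTo F ℰp J K ((Nat.le_succ J).trans hJK) ⁻¹' B ∩
                descendTo F ℰp (J + 1) K hJK ⁻¹' {V | PlaqSmall (θBal F.L γ (c * b₀) p₀ (J + 1)) V}) :=
  Summit.QuantumFields.YangMills.Theorems.FluctuationComparisonRegPrIntLPersistenceKFree.oneLevelPersistenceIntCan_of_up_low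
    (persLetters_of_stability hU hLo)

/-- By-name concluder from the two stubs (CONDITIONAL: the stubs are `sorry`d schemas; nothing of Bałaban's is proved). -/
theorem oneLevelPersistenceIntCan_of_stubs :
    ∀ (L : ℕ), ∃ c₀ : ℝ, 0 < c₀ ∧ c₀ ≤ 1 ∧ ∀ (c : ℝ), 0 < c → c ≤ c₀ → ∃ pS : ℝ, ∀ (b₀ p₀ : ℝ), 0 < b₀ → pS ≤ p₀ → 0 < p₀ →
      ∃ γ₁ : ℝ, 0 < γ₁ ∧ ∀ (F : T3Family) (γ : ℝ), F.L = L → 0 < γ → γ ≤ γ₁ →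
        ∀ (J : ℕ), ∃ q : ℝ, 0 < q ∧ ∀ (K : ℕ) (hJK : J + 1 ≤ K)
          (B : Set (GaugeField (F.P J) 0 (Matrix.specialUnitaryGroup (Fin 2) ℂ))), MeasurableSet B →
            B ⊆ {U | PlaqSmall (θBal F.L γ (c * b₀) p₀ J) U} →
            ENNReal.ofReal q * gibbsK F ℰp γ K (descendTo F ℰp J K ((Nat.le_succ J).trans hJK) ⁻¹' B) ≤
              gibbsK F ℰp γ K (descendTo F ℰp J K ((Nat.le_succ J).trans hJK) ⁻¹' B ∩
                descendTo F ℰp (J + 1) K hJK ⁻¹' {V | PlaqSmall (θBal F.L γ (c * b₀) p₀ (J + 1)) V}) :=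
  oneLevelPersistenceIntCan_of_stability stub_stabilityUpper stub_stabilityLowerWindow

/-! ## §6 (v2, advisory P4) LOWB∘ gives the tree's `HeightwiseLowerBoundOnSmall` in the row's prefix (PROVED corollary) -/

/-- **LOWB∘ ⇒ the ∀L∃γ₁-closure of lit `T3HeightwiseDensityBounds.HeightwiseLowerBoundOnSmall`** (price P4 of verdict #455; the critic's BC2 battery had
`LOWB∘ → (∀ L ∃ γ₁ … HeightwiseLowerBoundOnSmall F γ)` ✗ by automation, TRUE on paper): at `b₀ := max bB 1`, `p₀ := pB`, `γ₁ := min γᴸ 1`, the schema's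
`δ` at height `n` is the window radius `θBal F.L γ (max bB 1) pB n > 0` (`θBal_pos`, `1 ≤ L` from `F.hL`, `γ ≤ 1`) and its `c` is LOWB∘'s `cl`.  So LOWB∘ is
EXACTLY «`HeightwiseLowerBoundOnSmall` with the threshold pinned to Bałaban's window profile and `γ₁` after the profile» — the organ's lower letter and the
lit schema differ only in who chooses `δ`.  CONDITIONAL on LOWB∘ (a stub); nothing of Bałaban's is proved. [cite: Balaban1985UV3, (4)-(5) p.256 and (47) p.267] -/
theorem heightwiseLowerBoundOnSmall_of_stabilityLower (hLo : StabilityLowerWindowCan) :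
    ∀ (L : ℕ), ∃ γ₁ : ℝ, 0 < γ₁ ∧ ∀ (F : T3Family) (γ : ℝ), F.L = L → 0 < γ → γ ≤ γ₁ → HeightwiseLowerBoundOnSmall F γ := by
  intro L
  obtain ⟨bB, pB, hLoF⟩ := hLo L
  obtain ⟨γL, hγL, hLF⟩ := hLoF (max bB 1) pB (le_max_left _ _) le_rfl
  refine ⟨min γL 1, lt_min hγL one_pos, fun F γ hFL hγ hγle n => ?_⟩
  have hγL' : γ ≤ γL := hγle.trans (min_le_left _ _)
  have hγ1 : γ ≤ 1 := hγle.trans (min_le_right _ _)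
  obtain ⟨cl, hcl, hcllow⟩ := hLF F γ hFL hγ hγL' n
  exact ⟨θBal F.L γ (max bB 1) pB n, cl,
    θBal_pos F.hL.2.le hγ hγ1 (lt_of_lt_of_le one_pos (le_max_right bB 1)) pB n, hcl, fun K hK => hcllow K hK⟩

/-! ## §7 (v2) BOTH ORGAN ROWS ⟸ UP∘ + LOWB∘ AND NOTHING ELSE, THROUGH THE HANDS' ★★★★ KNITS OF 08:00∕08:05Z (PROVED junctions; rows NOT proved) -/

/-- ★★★ **TUBE∘ `SectionTubeMassIntCan` VERBATIM ⟸ UP∘ + LOWB∘ ALONE** — through w4-20520 g18's ✓`…TubeFromThm1.sectionTubeMassIntCan_of_heightwiseBounds`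
(08:05Z; ⟨HAAR-TUBE₁⟩ is now the hands' THEOREM `haarTube_noMargin_depthOne`, so v1's §4 third letter is gone): its hypothesis «`HeightwiseUpperBound F γ` ∧ ∀ J ∃ cl > 0,
floor on the DOUBLED window `{PlaqSmall 2θ_{J+1}(b₀)}`» is served by UP∘ and by LOWB∘ at the window constant `max (2b₀) bB` (`2θ(b₀) = θ(2b₀) ≤ θ(max (2b₀) bB)`,
`θBal_mul`, `θBal_le_of_mul_le`; `γ₁ := min γᵁ γᴸ 1`).  CONDITIONAL on the two rows; TUBE∘ is NOT proved. [cite: Balaban1985UV3, (5)-(7) pp.256-257 and Thm 1 p.257] -/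
theorem sectionTubeMassIntCan_of_stability (hU : StabilityUpperCan) (hLo : StabilityLowerWindowCan) :
    ∀ (L : ℕ), ∃ c₀ : ℝ, 0 < c₀ ∧ c₀ ≤ 1 ∧ ∀ (c : ℝ), 0 < c → c ≤ c₀ → ∃ pS : ℝ, ∀ (b₀ p₀ : ℝ), 0 < b₀ → pS ≤ p₀ → 0 < p₀ →
      ∃ γ₁ : ℝ, 0 < γ₁ ∧ ∀ (F : T3Family) (γ : ℝ), F.L = L → 0 < γ → γ ≤ γ₁ →
        ∀ (J : ℕ) (r : ℝ), 0 < r →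
          ∀ σ : GaugeField (F.P J) 0 (Matrix.specialUnitaryGroup (Fin 2) ℂ) → GaugeField (F.P (J + 1)) 0 (Matrix.specialUnitaryGroup (Fin 2) ℂ),
            Measurable σ →
            (∀ U : GaugeField (F.P J) 0 (Matrix.specialUnitaryGroup (Fin 2) ℂ), PlaqSmall (θBal F.L γ (c * b₀) p₀ J) U →
              descendTo F ℰp J (J + 1) (Nat.le_succ J) (σ U) = U ∧ PlaqSmall (θBal F.L γ b₀ p₀ (J + 1)) (σ U)) →
            ∃ q : ℝ, 0 < q ∧ ∀ (K : ℕ) (hJK : J + 1 ≤ K)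
              (B : Set (GaugeField (F.P J) 0 (Matrix.specialUnitaryGroup (Fin 2) ℂ))), MeasurableSet B →
                B ⊆ {U | PlaqSmall (θBal F.L γ (c * b₀) p₀ J) U} →
                ENNReal.ofReal q * gibbsK F ℰp γ K (descendTo F ℰp J K ((Nat.le_succ J).trans hJK) ⁻¹' B) ≤
                  gibbsK F ℰp γ K (descendTo F ℰp J K ((Nat.le_succ J).trans hJK) ⁻¹' B ∩
                    {V | ∀ b : PBond (F.P (J + 1)) 0,
                      dist1 ((σ (descendTo F ℰp J K ((Nat.le_succ J).trans hJK) V) b)⁻¹ *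
                        descendTo F ℰp (J + 1) K hJK V b) < r}) := by
  refine Summit.QuantumFields.YangMills.Theorems.FluctuationComparisonRegPrIntLTubeFromThm1.sectionTubeMassIntCan_of_heightwiseBounds fun L => ?_
  obtain ⟨γU, hγU, hUF⟩ := hU L
  obtain ⟨bB, pB, hLoF⟩ := hLo L
  refine ⟨1, one_pos, le_rfl, fun c hc hc1 => ⟨pB, fun b₀ p₀ hb₀ hpB hp₀ => ?_⟩⟩
  obtain ⟨γL, hγL, hLF⟩ := hLoF (max (2 * b₀) bB) p₀ (le_max_right _ _) hpB
  refine ⟨min (min γU γL) 1, lt_min (lt_min hγU hγL) one_pos, fun F γ hFL hγ hγle => ?_⟩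
  have hγU' : γ ≤ γU := hγle.trans ((min_le_left _ _).trans (min_le_left _ _))
  have hγL' : γ ≤ γL := hγle.trans ((min_le_left _ _).trans (min_le_right _ _))
  have hγ1 : γ ≤ 1 := hγle.trans (min_le_right _ _)
  refine ⟨hUF F γ hFL hγ hγU', fun J => ?_⟩
  obtain ⟨cl, hcl, hcllow⟩ := hLF F γ hFL hγ hγL' (J + 1)
  refine ⟨cl, hcl, fun K hJK => ?_⟩
  have hθ : 2 * θBal F.L γ b₀ p₀ (J + 1) ≤ θBal F.L γ (max (2 * b₀) bB) p₀ (J + 1) := by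
    rw [← θBal_mul F.L γ 2 b₀ p₀ (J + 1)]
    exact θBal_le_of_mul_le F.hL.2.le hγ hγ1 (le_max_left (2 * b₀) bB) p₀ (J + 1)
  filter_upwards [hcllow K hJK] with V hV hVS
  exact hV fun p => (hVS p).trans_le hθ

/-- ★★★ **PERS₁∘ VERBATIM ⟸ UP∘ + LOWB∘ ALONE, SECOND DERIVATION through LEAD w3-20520 g18's ✓`…PersistenceFromThm1.oneLevelPersistenceIntCan_of_heightwiseBounds`**
(08:00Z; §5's ★★★ goes through px8's ✓`…PersistenceKFree` directly — same mathematics, two names): UP∘ gives letter (i), LOWB∘ at the window constant `max b₀ bB` gives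
letter (ii) on the interior window `θ_{J+1}(c·b₀) ≤ θ_{J+1}(max b₀ bB)` (`c ≤ 1`).  CONDITIONAL on the two rows; PERS₁∘ is NOT proved.
[cite: Balaban1985UV3, (5)-(7) pp.256-257 and Thm 1 p.257] -/
theorem oneLevelPersistenceIntCan_of_stability' (hU : StabilityUpperCan) (hLo : StabilityLowerWindowCan) :
    ∀ (L : ℕ), ∃ c₀ : ℝ, 0 < c₀ ∧ c₀ ≤ 1 ∧ ∀ (c : ℝ), 0 < c → c ≤ c₀ → ∃ pS : ℝ, ∀ (b₀ p₀ : ℝ), 0 < b₀ → pS ≤ p₀ → 0 < p₀ →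
      ∃ γ₁ : ℝ, 0 < γ₁ ∧ ∀ (F : T3Family) (γ : ℝ), F.L = L → 0 < γ → γ ≤ γ₁ →
        ∀ (J : ℕ), ∃ q : ℝ, 0 < q ∧ ∀ (K : ℕ) (hJK : J + 1 ≤ K)
          (B : Set (GaugeField (F.P J) 0 (Matrix.specialUnitaryGroup (Fin 2) ℂ))), MeasurableSet B →
            B ⊆ {U | PlaqSmall (θBal F.L γ (c * b₀) p₀ J) U} →
            ENNReal.ofReal q * gibbsK F ℰp γ K (descendTo F ℰp J K ((Nat.le_succ J).trans hJK) ⁻¹' B) ≤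
              gibbsK F ℰp γ K (descendTo F ℰp J K ((Nat.le_succ J).trans hJK) ⁻¹' B ∩
                descendTo F ℰp (J + 1) K hJK ⁻¹' {V | PlaqSmall (θBal F.L γ (c * b₀) p₀ (J + 1)) V}) := by
  refine Summit.QuantumFields.YangMills.Theorems.FluctuationComparisonRegPrIntLPersistenceFromThm1.oneLevelPersistenceIntCan_of_heightwiseBounds fun L => ?_
  obtain ⟨γU, hγU, hUF⟩ := hU L
  obtain ⟨bB, pB, hLoF⟩ := hLo L
  refine ⟨1, one_pos, le_rfl, fun c hc hc1 => ⟨pB, fun b₀ p₀ hb₀ hpB hp₀ => ?_⟩⟩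
  obtain ⟨γL, hγL, hLF⟩ := hLoF (max b₀ bB) p₀ (le_max_right _ _) hpB
  refine ⟨min (min γU γL) 1, lt_min (lt_min hγU hγL) one_pos, fun F γ hFL hγ hγle => ?_⟩
  have hγU' : γ ≤ γU := hγle.trans ((min_le_left _ _).trans (min_le_left _ _))
  have hγL' : γ ≤ γL := hγle.trans ((min_le_left _ _).trans (min_le_right _ _))
  have hγ1 : γ ≤ 1 := hγle.trans (min_le_right _ _)
  refine ⟨hUF F γ hFL hγ hγU', fun J => ?_⟩
  obtain ⟨cl, hcl, hcllow⟩ := hLF F γ hFL hγ hγL' (J + 1)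
  refine ⟨cl, hcl, fun K hJK => ?_⟩
  have hθ : θBal F.L γ (c * b₀) p₀ (J + 1) ≤ θBal F.L γ (max b₀ bB) p₀ (J + 1) :=
    θBal_le_of_mul_le F.hL.2.le hγ hγ1 ((mul_le_of_le_one_left hb₀.le hc1).trans (le_max_left _ _)) p₀ (J + 1)
  filter_upwards [hcllow K hJK] with V hV hVS
  exact hV fun p => (hVS p).trans_le hθ

end Summit.QuantumFields.YangMills.Cruxes.FluctuationComparisonRegPrIntL.StabilityLetters

end
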